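import Literature.Topology.FourManifolds.LatticeFormsEichlerTransvectionsCommutators
import Literature.Topology.FourManifolds.LatticeFormsReflectionsUnimodularTransvections
import Literature.Topology.FourManifolds.LatticeFormsTwoHyperbolicPlanesSpecialOrthogonal
import HarnessLib

/-!
# `E(L)` is perfect for an even lattice with three hyperbolic planes: every unimodular transvection is a product of
# commutators of unimodular transvections (the integral case of Gritsenko–Hulek–Sankaran, *J. Algebra* 322 (2009)
# §4.1, Thm. 1.7 "`S̃O⁺(L)^{ab}` is trivial")

Trunk T-4MAN vocabulary. Sequel of `LatticeFormsEichlerTransvectionsCommutators.lean` (row g49-#5: with a third hyperbolic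
pair, `t(e,e₁) = [t(e,f₁),t(e₁,e₂)]·[t(e,f₁),t(e₁,f₂)]·[t(e,f₁),t(e₁,−e₂−f₂)]`), `LatticeFormsReflectionsUnimodularTransvections.lean`
(g49-#1: Prop. 3.3 (ii), a unimodular transvection `t(u,a)` is an admissible word in `E_U(L₁)`) and
`LatticeFormsTwoHyperbolicPlanesSpecialOrthogonal.lean` (g49-#4: `t(e, ca) = t(e,a)^c` as a word). Written for lane
`lit-hodgefound` (Track 2 foundations; prover seat `lit-hodgefound-p18`, gen 49, row g49-#6). THEOREMS ONLY — no definition,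
no named fact, no instance, no notation.

## Source, verbatim (held text `paper:arxiv-0810.1614`, Thm. 1.7 p. 4 and §4.1 p. 8)

"**Theorem 1.7.** Let `L` be an even integral lattice containing at least two hyperbolic planes, such that `rank₂(L) ≥ 6`
and `rank₃(L) ≥ 5`. Then `S̃O⁺(L)^{ab}` is trivial and `Õ⁺(L)^{ab} ≅ ℤ/2ℤ`." (Proof, §4.1:) "It is enough to prove Theorem 1.7
for `S̃O⁺(L)` (or, equivalently by equation (16) [`S̃O⁺(L) = E(L) = E_U(L₁)`], for `E(L)`) […] According to Proposition 3.3
(ii), the group `E(L)` is generated by all `t(e,u)` and `t(f,v)` where `u, v ∈ L₁`. We prove that these generators are the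
products of commutators […] we obtain `t(e,e₁)` as the product of three commutators […] The same argument works for
`t(e,f₁)`. Then we can replace `e₁` by any unimodular isotropic vector of the form `e₁' = e₁ + w − (w²/2)f₁` where `w ∈ L₀`.
We note that `(e₁',f₁) = 1`. We can repeat the arguments above for this new hyperbolic plane `U₁' = ⟨e₁',f₁⟩` and we obtain
that `t(e, e₁ + w − (w²/2)f₁)` belongs to the commutator subgroup […]. Using `t(e,e₁)`, `t(e,f₁)` and
`t(e, e₁ + w − (w²/2)f₁)`, we see that `t(e,l)` for any `l ∈ L₁` is a commutator [product] […]"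

## Contents (all proved) and reading notes

* INTEGRAL READING. GHS prove the local statements (`E(L ⊗ ℤ_p)`) and glue them by strong approximation and the congruence
  subgroup property, because for a general `L₀` the vectors `u, v` of the three-commutator formula exist only `p`-adically.
  When `L₀` itself contains a hyperbolic plane `U₂ = ⟨e₂, f₂⟩` — i.e. `L ⊇ U ⊕ U₁ ⊕ U₂`, as for the Beauville–Bogomolov
  lattices `3U ⊕ 2E₈(−1) ⊕ ⟨2−2n⟩` and `3U ⊕ ⟨−2n−2⟩` — the printed argument runs over `ℤ` verbatim, which is what this file
  does: the conclusion is that **every element of `E_U(L₁)` (= `E(L)`, Prop. 3.3 (ii)) is a product of commutators of elements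
  of `E_U(L₁)`**, i.e. `E(L)` is perfect; with Prop. 3.4 (`S̃O⁺(L) = E(L)`, Kneser — NOT in the tree) this is the first half
  of Thm. 1.7 for such `L`.
* VOCABULARY: `E_U(L₁)`-elements are the admissible words `UGen.evalEquiv … l hl` of `LatticeFormsEichlerTransitivity.lean`
  (base pair `x, y` = GHS's `f, e`); a commutator is `[α,β] = αβα⁻¹β⁻¹ = ((β⁻¹.trans α⁻¹).trans β).trans α`; the statements
  quantify over ANY set `C` of isometries containing all commutators of admissible words and conclude `IsWordIn C _` (so
  they apply to the commutator set itself and to every larger set). The setting is a symmetric even `(W,B)` with three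
  mutually orthogonal hyperbolic pairs `(x,y)`, `(x₁,y₁)`, `(x₂,y₂)` (three `TwoHyperbolicPairs` instances).
* §1 Plumbing: `TwoHyperbolicPairs` under isometries and permutations of the pairs; `E_U` for the base `(y,x)` is `E_U` for
  `(x,y)`; commutators of `(y,x)`-words lie in `C`.
* §2 **`t(e,e₁) ∈ [E,E]`** (`isWordIn_commutators_eichlerTransvection_y_y₁`: the three commutators of g49-#5, whose
  entries `t(e,f₁)` and `t(e₁,·)` are admissible words), hence `t(e,f₁)`, `t(f,e₁)`, `t(f,f₁)` and their powers.
* §3 **`t(e, e₁ + w − q_w f₁) ∈ [E,E]`** for `w ∈ L₀` — §2 for the hyperbolic pairs transported by `τ = t(f₁,w)`, which fixes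
  `e, f, f₁` and maps `e₁ ↦ e₁ + w − q_w f₁` (`isWordIn_commutators_eichlerTransvection_y_conj`); then
  **`t(e,w) = t(e,e₁') t(e,−e₁) t(e, q_w f₁) ∈ [E,E]`** (`isWordIn_commutators_eichlerTransvection_y_of_ortho`).
* §4 **Every admissible letter and every admissible word lies in `[E,E]`** (`isWordIn_commutators_toIsometryEquiv`,
  `isWordIn_commutators_evalEquiv`: decompose `a = αf₁' … `, precisely `a = (a,e₁)f₁ + (a,f₁)e₁ + w`) — "`E(L)` is perfect".
-/

noncomputable section

open Module
open LinearMap (BilinForm)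
open LinearMap.BilinForm (IsometryEquiv)

namespace Literature.Topology.FourManifolds

variable {W : Type*} [AddCommGroup W] {B : BilinForm ℤ W}

/-! ### §1 Plumbing: transported and permuted hyperbolic pairs; the base pair `(y, x)` -/

section Plumbing

variable {x y x₁ y₁ : W}

/-- An isometry carries two orthogonal hyperbolic pairs to two orthogonal hyperbolic pairs. [cite: GritsenkoHulekSankaran2009, §4.1 ("we can replace e₁ by any unimodular isotropic vector e₁' …")] -/
theorem TwoHyperbolicPairs.map (h : TwoHyperbolicPairs B x y x₁ y₁) (φ : B.IsometryEquiv B) :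
    TwoHyperbolicPairs B (φ x) (φ y) (φ x₁) (φ y₁) :=
  ⟨h.isSymm, by rw [φ.map_app]; exact h.xx, by rw [φ.map_app]; exact h.yy, by rw [φ.map_app]; exact h.xy,
    by rw [φ.map_app]; exact h.x₁x₁, by rw [φ.map_app]; exact h.y₁y₁, by rw [φ.map_app]; exact h.x₁y₁,
    by rw [φ.map_app]; exact h.xx₁, by rw [φ.map_app]; exact h.xy₁, by rw [φ.map_app]; exact h.yx₁,
    by rw [φ.map_app]; exact h.yy₁⟩

/-- Exchanging `x₁ ↔ y₁`. [cite: GritsenkoHulekSankaran2009, §4.1 ("The same argument works for t(e,f₁)")] -/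
theorem TwoHyperbolicPairs.symm_right (h : TwoHyperbolicPairs B x y x₁ y₁) : TwoHyperbolicPairs B x y y₁ x₁ :=
  ⟨h.isSymm, h.xx, h.yy, h.xy, h.y₁y₁, h.x₁x₁, h.y₁x₁, h.xy₁, h.xx₁, h.yy₁, h.yx₁⟩

/-- Exchanging `x ↔ y`. [cite: GritsenkoHulekSankaran2009, §4.1 ("t(e,u) and t(f,v)")] -/
theorem TwoHyperbolicPairs.symm_left (h : TwoHyperbolicPairs B x y x₁ y₁) : TwoHyperbolicPairs B y x x₁ y₁ :=
  ⟨h.isSymm, h.yy, h.xx, h.yx, h.x₁x₁, h.y₁y₁, h.x₁y₁, h.yx₁, h.yy₁, h.xx₁, h.xy₁⟩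

/-- Exchanging the two pairs. [cite: GritsenkoHulekSankaran2009, §3.2 ("U ⊕ U₁")] -/
theorem TwoHyperbolicPairs.swap (h : TwoHyperbolicPairs B x y x₁ y₁) : TwoHyperbolicPairs B x₁ y₁ x y :=
  ⟨h.isSymm, h.x₁x₁, h.y₁y₁, h.x₁y₁, h.xx, h.yy, h.xy, h.x₁x, h.x₁y, h.y₁x, h.y₁y⟩

/-- **`E_U` does not depend on the order of the base pair**: an admissible word for the base `(y, x)` is an admissible
word for `(x, y)` (the letters `E(x,a,q)`, `E(y,a,q)` are relabelled). [cite: GritsenkoHulekSankaran2009, §3.3 ("E_U(L₁) := ⟨t(e,a), t(f,a)⟩")] -/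
theorem UGen.exists_eval_base_swap (l : List (UGen W)) (hl : ∀ g ∈ l, g.IsAdmissible B y x) :
    ∃ l' : List (UGen W), (∀ g ∈ l', g.IsAdmissible B x y) ∧ ∀ v, UGen.eval B y x l v = UGen.eval B x y l' v := by
  induction l with
  | nil => exact ⟨[], fun g hg ↦ (List.not_mem_nil hg).elim, fun v ↦ rfl⟩
  | cons g l ih =>
    obtain ⟨l', hl', hll'⟩ := ih fun g' hg' ↦ hl g' (List.mem_cons_of_mem g hg')
    have hg := hl g List.mem_cons_self
    cases g with
    | atY a q =>
      refine ⟨UGen.atX a q :: l', fun k hk ↦ ?_, fun v ↦ ?_⟩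
      · rcases List.mem_cons.1 hk with rfl | hk
        · exact ⟨hg.2.1, hg.1, hg.2.2⟩
        · exact hl' k hk
      · rw [UGen.eval_cons, UGen.eval_cons, LinearMap.comp_apply, LinearMap.comp_apply, hll']
        rfl
    | atX a q =>
      refine ⟨UGen.atY a q :: l', fun k hk ↦ ?_, fun v ↦ ?_⟩
      · rcases List.mem_cons.1 hk with rfl | hk
        · exact ⟨hg.2.1, hg.1, hg.2.2⟩
        · exact hl' k hk
      · rw [UGen.eval_cons, UGen.eval_cons, LinearMap.comp_apply, LinearMap.comp_apply, hll']
        rfl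

/-- The bundled version: `UGen.evalEquiv` for the base `(y, x)` equals some `UGen.evalEquiv` for `(x, y)`.
[cite: GritsenkoHulekSankaran2009, §3.3 ("E_U(L₁) := ⟨t(e,a), t(f,a)⟩")] -/
theorem UGen.exists_evalEquiv_base_swap (hB : B.IsSymm) (hxx : B x x = 0) (hyy : B y y = 0) (l : List (UGen W))
    (hl : ∀ g ∈ l, g.IsAdmissible B y x) :
    ∃ (l' : List (UGen W)) (hl' : ∀ g ∈ l', g.IsAdmissible B x y),
      UGen.evalEquiv hB hyy hxx l hl = UGen.evalEquiv hB hxx hyy l' hl' := by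
  obtain ⟨l', hl', hll'⟩ := UGen.exists_eval_base_swap l hl
  exact ⟨l', hl', DFunLike.ext _ _ fun v ↦ by rw [UGen.evalEquiv_apply, UGen.evalEquiv_apply, hll']⟩

/-- A set containing the commutators `[α,β] = αβα⁻¹β⁻¹` of all admissible words for the base `(x,y)` contains those for
the base `(y,x)`. [cite: GritsenkoHulekSankaran2009, §4.1] -/
theorem forall_comm_mem_base_swap (hB : B.IsSymm) (hxx : B x x = 0) (hyy : B y y = 0) {C : Set (B.IsometryEquiv B)}
    (hC : ∀ (l₁ l₂ : List (UGen W)) (hl₁ : ∀ g ∈ l₁, g.IsAdmissible B x y) (hl₂ : ∀ g ∈ l₂, g.IsAdmissible B x y),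
      (((UGen.evalEquiv hB hxx hyy l₂ hl₂).symm.trans (UGen.evalEquiv hB hxx hyy l₁ hl₁).symm).trans
          (UGen.evalEquiv hB hxx hyy l₂ hl₂)).trans (UGen.evalEquiv hB hxx hyy l₁ hl₁) ∈ C) :
    ∀ (l₁ l₂ : List (UGen W)) (hl₁ : ∀ g ∈ l₁, g.IsAdmissible B y x) (hl₂ : ∀ g ∈ l₂, g.IsAdmissible B y x),
      (((UGen.evalEquiv hB hyy hxx l₂ hl₂).symm.trans (UGen.evalEquiv hB hyy hxx l₁ hl₁).symm).trans
          (UGen.evalEquiv hB hyy hxx l₂ hl₂)).trans (UGen.evalEquiv hB hyy hxx l₁ hl₁) ∈ C := by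
  intro l₁ l₂ hl₁ hl₂
  obtain ⟨l₁', hl₁', h₁⟩ := UGen.exists_evalEquiv_base_swap hB hxx hyy l₁ hl₁
  obtain ⟨l₂', hl₂', h₂⟩ := UGen.exists_evalEquiv_base_swap hB hxx hyy l₂ hl₂
  rw [h₁, h₂]
  exact hC l₁' l₂' hl₁' hl₂'

/-- A single admissible letter is the admissible word of length one. [cite: GritsenkoHulekSankaran2009, §3.3] -/
theorem UGen.evalEquiv_singleton (hB : B.IsSymm) (hxx : B x x = 0) (hyy : B y y = 0) (g : UGen W)
    (hg : g.IsAdmissible B x y) :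
    UGen.evalEquiv hB hxx hyy [g] (fun g' hg' ↦ by rw [List.mem_singleton.1 hg']; exact hg) =
      UGen.toIsometryEquiv hB hxx hyy g hg :=
  DFunLike.ext _ _ fun v ↦ by rw [UGen.evalEquiv_apply, UGen.toIsometryEquiv_apply, UGen.eval_cons, UGen.eval_nil,
    LinearMap.comp_id]

end Plumbing

/-! ### §2 `t(e,e₁)` is a product of three commutators in `E_U(L₁)` -/

section Three

variable {x y x₁ y₁ x₂ y₂ : W}

/-- **`t(e,e₁) ∈ [E_U(L₁), E_U(L₁)]`** for an even `(W,B)` with three orthogonal hyperbolic pairs: `E(y,y₁,0)` is a word in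
any set `C` containing the commutators of admissible words — the three commutators of g49-#5, whose entries `t(e,f₁) =
E(y,x₁,0)` (an admissible letter) and `t(e₁,·)` (an admissible word by Prop. 3.3 (ii)) lie in `E_U(L₁)`.
[cite: GritsenkoHulekSankaran2009, §4.1 ("we obtain t(e,e₁) as the product of three commutators")] -/
theorem isWordIn_commutators_eichlerTransvection_y_y₁ (h₁ : TwoHyperbolicPairs B x y x₁ y₁)
    (h₂ : TwoHyperbolicPairs B x y x₂ y₂) (h₁₂ : TwoHyperbolicPairs B x₁ y₁ x₂ y₂) (hev : B.IsEven)
    {C : Set (B.IsometryEquiv B)}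
    (hC : ∀ (l₁ l₂ : List (UGen W)) (hl₁ : ∀ g ∈ l₁, g.IsAdmissible B x y) (hl₂ : ∀ g ∈ l₂, g.IsAdmissible B x y),
      (((UGen.evalEquiv h₁.isSymm h₁.xx h₁.yy l₂ hl₂).symm.trans (UGen.evalEquiv h₁.isSymm h₁.xx h₁.yy l₁ hl₁).symm).trans
          (UGen.evalEquiv h₁.isSymm h₁.xx h₁.yy l₂ hl₂)).trans (UGen.evalEquiv h₁.isSymm h₁.xx h₁.yy l₁ hl₁) ∈ C)
    (hy₁ : B y₁ y₁ = 0 + 0) :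
    IsWordIn C (LinearMap.BilinForm.IsometryEquiv.eichlerTransvection B h₁.isSymm y y₁ 0 h₁.yy h₁.yy₁ hy₁) := by
  have hB := h₁.isSymm
  -- the letter `A = t(e,f₁) = E(y,x₁,0)` as an admissible word
  have hA : (UGen.atY x₁ (0 : ℤ)).IsAdmissible B x y := ⟨h₁.xx₁, h₁.yx₁, by rw [h₁.x₁x₁, add_zero]⟩
  have hlA' : ∀ g ∈ [UGen.atY x₁ (0 : ℤ)], g.IsAdmissible B x y := fun g hg ↦ by
    rw [List.mem_singleton.1 hg]; exact hA
  set lA : List (UGen W) := [UGen.atY x₁ 0] with hlA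
  have hAv : ∀ v, UGen.evalEquiv hB h₁.xx h₁.yy lA hlA' v = B.eichlerTransvection y x₁ 0 v := fun v ↦ by
    rw [UGen.evalEquiv_apply, hlA, UGen.eval_cons, UGen.eval_nil, LinearMap.comp_id]
    rfl
  have hAs : ∀ v, (UGen.evalEquiv hB h₁.xx h₁.yy lA hlA').symm v = B.eichlerTransvection y (-x₁) 0 v := fun v ↦ by
    rw [UGen.evalEquiv_singleton hB h₁.xx h₁.yy _ hA]
    rfl
  -- the three `t(e₁, w)` as admissible words
  have hw₃ : B (-x₂ - y₂) (-x₂ - y₂) = 1 + 1 := by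
    simp only [map_sub, map_neg, LinearMap.sub_apply, LinearMap.neg_apply, h₂.x₁x₁, h₂.y₁y₁, h₂.x₁y₁, h₂.y₁x₁]
    ring
  have hy₁w₃ : B y₁ (-x₂ - y₂) = 0 := by rw [map_sub, map_neg, h₁₂.yx₁, h₁₂.yy₁, neg_zero, sub_zero]
  obtain ⟨l₁, hl₁, hl₁v⟩ := exists_uGens_eichlerTransvection_eq h₁ hev (u := y₁) (z := x₁) (a := x₂) (q := 0) h₁.y₁y₁
    h₁.y₁x₁ h₁₂.yx₁ (by rw [h₂.x₁x₁, add_zero])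
  obtain ⟨l₂, hl₂, hl₂v⟩ := exists_uGens_eichlerTransvection_eq h₁ hev (u := y₁) (z := x₁) (a := y₂) (q := 0) h₁.y₁y₁
    h₁.y₁x₁ h₁₂.yy₁ (by rw [h₂.y₁y₁, add_zero])
  obtain ⟨l₃, hl₃, hl₃v⟩ := exists_uGens_eichlerTransvection_eq h₁ hev (u := y₁) (z := x₁) (a := -x₂ - y₂) (q := 1)
    h₁.y₁y₁ h₁.y₁x₁ hy₁w₃ hw₃
  have hE₁ : UGen.evalEquiv hB h₁.xx h₁.yy l₁ hl₁ = LinearMap.BilinForm.IsometryEquiv.eichlerTransvection B hB y₁ x₂ 0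
      h₁.y₁y₁ h₁₂.yx₁ (by rw [h₂.x₁x₁, add_zero]) :=
    DFunLike.ext _ _ fun v ↦ by
      rw [UGen.evalEquiv_apply, LinearMap.BilinForm.IsometryEquiv.eichlerTransvection_apply, hl₁v]
  have hE₂ : UGen.evalEquiv hB h₁.xx h₁.yy l₂ hl₂ = LinearMap.BilinForm.IsometryEquiv.eichlerTransvection B hB y₁ y₂ 0
      h₁.y₁y₁ h₁₂.yy₁ (by rw [h₂.y₁y₁, add_zero]) :=
    DFunLike.ext _ _ fun v ↦ by
      rw [UGen.evalEquiv_apply, LinearMap.BilinForm.IsometryEquiv.eichlerTransvection_apply, hl₂v]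
  have hE₃ : UGen.evalEquiv hB h₁.xx h₁.yy l₃ hl₃ = LinearMap.BilinForm.IsometryEquiv.eichlerTransvection B hB y₁
      (-x₂ - y₂) 1 h₁.y₁y₁ hy₁w₃ hw₃ :=
    DFunLike.ext _ _ fun v ↦ by
      rw [UGen.evalEquiv_apply, LinearMap.BilinForm.IsometryEquiv.eichlerTransvection_apply, hl₃v]
  -- the identity of g49-#5
  have key := eichlerTransvection_y_y₁_eq_three_commutators h₁ h₂ h₁₂
  rw [neg_one_smul ℤ x₁, neg_neg] at key
  -- the word `[A,B₃] · [A,B₂] · [A,B₁]` read right to left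
  refine ⟨[(((UGen.evalEquiv hB h₁.xx h₁.yy l₃ hl₃).symm.trans (UGen.evalEquiv hB h₁.xx h₁.yy lA hlA').symm).trans
      (UGen.evalEquiv hB h₁.xx h₁.yy l₃ hl₃)).trans (UGen.evalEquiv hB h₁.xx h₁.yy lA hlA'),
    (((UGen.evalEquiv hB h₁.xx h₁.yy l₂ hl₂).symm.trans (UGen.evalEquiv hB h₁.xx h₁.yy lA hlA').symm).trans
      (UGen.evalEquiv hB h₁.xx h₁.yy l₂ hl₂)).trans (UGen.evalEquiv hB h₁.xx h₁.yy lA hlA'),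
    (((UGen.evalEquiv hB h₁.xx h₁.yy l₁ hl₁).symm.trans (UGen.evalEquiv hB h₁.xx h₁.yy lA hlA').symm).trans
      (UGen.evalEquiv hB h₁.xx h₁.yy l₁ hl₁)).trans (UGen.evalEquiv hB h₁.xx h₁.yy lA hlA')], fun ψ hψ ↦ ?_, fun v ↦ ?_⟩
  · simp only [List.mem_cons, List.not_mem_nil, or_false] at hψ
    rcases hψ with rfl | rfl | rfl
    · exact Or.inl (hC lA l₃ hlA' hl₃)
    · exact Or.inl (hC lA l₂ hlA' hl₂)
    · exact Or.inl (hC lA l₁ hlA' hl₁)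
  · change wordProd _ v = _
    rw [wordProd_cons, wordProd_cons, wordProd_cons, wordProd_nil]
    simp only [LinearMap.BilinForm.IsometryEquiv.trans_apply, LinearMap.BilinForm.IsometryEquiv.refl_apply, hAv, hAs, hE₁, hE₂,
      hE₃, LinearMap.BilinForm.IsometryEquiv.eichlerTransvection_apply,
      LinearMap.BilinForm.IsometryEquiv.eichlerTransvection_symm_apply]
    rw [key]
    simp only [LinearMap.comp_apply]


/-- **`t(e,f₁)`, and every power `t(e, c f₁)`, lies in `[E_U(L₁), E_U(L₁)]`** ("The same argument works for `t(e,f₁)`":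
§2 with `e₁ ↔ f₁`, then `t(e, cf₁) = t(e,f₁)^c`). [cite: GritsenkoHulekSankaran2009, §4.1] -/
theorem isWordIn_commutators_eichlerTransvection_y_smul_x₁ (h₁ : TwoHyperbolicPairs B x y x₁ y₁)
    (h₂ : TwoHyperbolicPairs B x y x₂ y₂) (h₁₂ : TwoHyperbolicPairs B x₁ y₁ x₂ y₂) (hev : B.IsEven)
    {C : Set (B.IsometryEquiv B)}
    (hC : ∀ (l₁ l₂ : List (UGen W)) (hl₁ : ∀ g ∈ l₁, g.IsAdmissible B x y) (hl₂ : ∀ g ∈ l₂, g.IsAdmissible B x y),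
      (((UGen.evalEquiv h₁.isSymm h₁.xx h₁.yy l₂ hl₂).symm.trans (UGen.evalEquiv h₁.isSymm h₁.xx h₁.yy l₁ hl₁).symm).trans
          (UGen.evalEquiv h₁.isSymm h₁.xx h₁.yy l₂ hl₂)).trans (UGen.evalEquiv h₁.isSymm h₁.xx h₁.yy l₁ hl₁) ∈ C)
    (c : ℤ) (hyc : B y (c • x₁) = 0) (hcc : B (c • x₁) (c • x₁) = 0 + 0) :
    IsWordIn C (LinearMap.BilinForm.IsometryEquiv.eichlerTransvection B h₁.isSymm y (c • x₁) 0 h₁.yy hyc hcc) := by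
  have hx₁ : B x₁ x₁ = 0 + 0 := by rw [h₁.x₁x₁, add_zero]
  refine (isWordIn_eichlerTransvection_zsmul h₁.isSymm h₁.yy h₁.yx₁ hx₁ c hyc hcc).bind fun s hs ↦ ?_
  rw [Set.mem_singleton_iff.1 hs]
  exact isWordIn_commutators_eichlerTransvection_y_y₁ h₁.symm_right h₂ h₁₂.symm_left hev hC hx₁

/-- **Every power `t(e, c e₁)` lies in `[E_U(L₁), E_U(L₁)]`.** [cite: GritsenkoHulekSankaran2009, §4.1] -/
theorem isWordIn_commutators_eichlerTransvection_y_smul_y₁ (h₁ : TwoHyperbolicPairs B x y x₁ y₁)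
    (h₂ : TwoHyperbolicPairs B x y x₂ y₂) (h₁₂ : TwoHyperbolicPairs B x₁ y₁ x₂ y₂) (hev : B.IsEven)
    {C : Set (B.IsometryEquiv B)}
    (hC : ∀ (l₁ l₂ : List (UGen W)) (hl₁ : ∀ g ∈ l₁, g.IsAdmissible B x y) (hl₂ : ∀ g ∈ l₂, g.IsAdmissible B x y),
      (((UGen.evalEquiv h₁.isSymm h₁.xx h₁.yy l₂ hl₂).symm.trans (UGen.evalEquiv h₁.isSymm h₁.xx h₁.yy l₁ hl₁).symm).trans
          (UGen.evalEquiv h₁.isSymm h₁.xx h₁.yy l₂ hl₂)).trans (UGen.evalEquiv h₁.isSymm h₁.xx h₁.yy l₁ hl₁) ∈ C)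
    (c : ℤ) (hyc : B y (c • y₁) = 0) (hcc : B (c • y₁) (c • y₁) = 0 + 0) :
    IsWordIn C (LinearMap.BilinForm.IsometryEquiv.eichlerTransvection B h₁.isSymm y (c • y₁) 0 h₁.yy hyc hcc) := by
  have hy₁ : B y₁ y₁ = 0 + 0 := by rw [h₁.y₁y₁, add_zero]
  refine (isWordIn_eichlerTransvection_zsmul h₁.isSymm h₁.yy h₁.yy₁ hy₁ c hyc hcc).bind fun s hs ↦ ?_
  rw [Set.mem_singleton_iff.1 hs]
  exact isWordIn_commutators_eichlerTransvection_y_y₁ h₁ h₂ h₁₂ hev hC hy₁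

end Three

/-! ### §3 `t(e, e₁ + w − q_w f₁)` and `t(e, w)` for `w ∈ L₀` -/

section Transport

variable {x y x₁ y₁ x₂ y₂ w : W} {q : ℤ}

/-- `τ = t(f₁, w) = E(x₁, w, q_w)` fixes the vectors orthogonal to `f₁` and `w`. [cite: GritsenkoHulekSankaran2009, §4.1 ("e₁' = e₁ + w − (w²/2)f₁")] -/
theorem eichlerTransvection_x₁_apply_of_ortho {z : W} (hx₁z : B x₁ z = 0) (hwz : B w z = 0) :
    B.eichlerTransvection x₁ w q z = z := by
  rw [LinearMap.BilinForm.eichlerTransvection_apply, hx₁z, hwz, zero_smul, zero_smul, mul_zero, zero_smul, add_zero,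
    sub_zero, sub_zero]

/-- `τ = E(x₁, w, q_w)` sends `e₁ = y₁` to `e₁' = y₁ + w − q_w x₁` (`(f₁,e₁) = 1`, `w ⊥ e₁`).
[cite: GritsenkoHulekSankaran2009, §4.1 ("e₁' = e₁ + w − (w²/2)f₁")] -/
theorem eichlerTransvection_x₁_apply_y₁ (hB : B.IsSymm) (hx₁y₁ : B x₁ y₁ = 1) (hy₁w : B y₁ w = 0) :
    B.eichlerTransvection x₁ w q y₁ = y₁ + w - q • x₁ := by
  have hwy₁ : B w y₁ = 0 := by rw [hB.eq, hy₁w]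
  rw [LinearMap.BilinForm.eichlerTransvection_apply, hx₁y₁, hwy₁, one_smul, zero_smul, sub_zero, mul_one]

/-- **`t(e, e₁') ∈ [E_U(L₁), E_U(L₁)]` for `e₁' = e₁ + w − q_w f₁`, `w ∈ L₀`** ("We can repeat the arguments above for
this new hyperbolic plane `U₁' = ⟨e₁', f₁⟩`"): §2 for the three hyperbolic pairs transported by the isometry
`τ = t(f₁,w)`, which fixes `e, f, f₁`. [cite: GritsenkoHulekSankaran2009, §4.1] -/
theorem isWordIn_commutators_eichlerTransvection_y_transport (h₁ : TwoHyperbolicPairs B x y x₁ y₁)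
    (h₂ : TwoHyperbolicPairs B x y x₂ y₂) (h₁₂ : TwoHyperbolicPairs B x₁ y₁ x₂ y₂) (hev : B.IsEven)
    {C : Set (B.IsometryEquiv B)}
    (hC : ∀ (l₁ l₂ : List (UGen W)) (hl₁ : ∀ g ∈ l₁, g.IsAdmissible B x y) (hl₂ : ∀ g ∈ l₂, g.IsAdmissible B x y),
      (((UGen.evalEquiv h₁.isSymm h₁.xx h₁.yy l₂ hl₂).symm.trans (UGen.evalEquiv h₁.isSymm h₁.xx h₁.yy l₁ hl₁).symm).trans
          (UGen.evalEquiv h₁.isSymm h₁.xx h₁.yy l₂ hl₂)).trans (UGen.evalEquiv h₁.isSymm h₁.xx h₁.yy l₁ hl₁) ∈ C)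
    (hxw : B x w = 0) (hyw : B y w = 0) (hx₁w : B x₁ w = 0) (hy₁w : B y₁ w = 0) (hww : B w w = q + q)
    (hy' : B y (y₁ + w - q • x₁) = 0) (hn : B (y₁ + w - q • x₁) (y₁ + w - q • x₁) = 0 + 0) :
    IsWordIn C (LinearMap.BilinForm.IsometryEquiv.eichlerTransvection B h₁.isSymm y (y₁ + w - q • x₁) 0 h₁.yy hy' hn) := by
  have hB := h₁.isSymm
  set τ := LinearMap.BilinForm.IsometryEquiv.eichlerTransvection B hB x₁ w q h₁.x₁x₁ hx₁w hww with hτ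
  have hwx : B w x = 0 := by rw [hB.eq, hxw]
  have hwy : B w y = 0 := by rw [hB.eq, hyw]
  have hτx : τ x = x := by
    rw [hτ, LinearMap.BilinForm.IsometryEquiv.eichlerTransvection_apply]
    exact eichlerTransvection_x₁_apply_of_ortho h₁.x₁x hwx
  have hτy : τ y = y := by
    rw [hτ, LinearMap.BilinForm.IsometryEquiv.eichlerTransvection_apply]
    exact eichlerTransvection_x₁_apply_of_ortho h₁.x₁y hwy
  have hτx₁ : τ x₁ = x₁ := by
    rw [hτ, LinearMap.BilinForm.IsometryEquiv.eichlerTransvection_apply]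
    exact LinearMap.BilinForm.eichlerTransvection_apply_self B h₁.x₁x₁ (by rw [hB.eq, hx₁w]) q
  have hτy₁ : τ y₁ = y₁ + w - q • x₁ := by
    rw [hτ, LinearMap.BilinForm.IsometryEquiv.eichlerTransvection_apply]
    exact eichlerTransvection_x₁_apply_y₁ hB h₁.x₁y₁ hy₁w
  have H₁ := h₁.map τ
  have H₂ := h₂.map τ
  have H₁₂ := h₁₂.map τ
  rw [hτx, hτy, hτx₁, hτy₁] at H₁
  rw [hτx, hτy] at H₂
  rw [hτx₁, hτy₁] at H₁₂
  exact isWordIn_commutators_eichlerTransvection_y_y₁ H₁ H₂ H₁₂ hev hC hn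

/-- **`t(e, w) ∈ [E_U(L₁), E_U(L₁)]` for every `w ∈ L₀ = (U ⊕ U₁)^⊥`** ("Using `t(e,e₁)`, `t(e,f₁)` and `t(e, e₁ + w − (w²/2)f₁)`
…"): `t(e,w) = t(e, e₁') t(e, −e₁) t(e, q_w f₁)` by (t3). [cite: GritsenkoHulekSankaran2009, §4.1] -/
theorem isWordIn_commutators_eichlerTransvection_y_of_ortho (h₁ : TwoHyperbolicPairs B x y x₁ y₁)
    (h₂ : TwoHyperbolicPairs B x y x₂ y₂) (h₁₂ : TwoHyperbolicPairs B x₁ y₁ x₂ y₂) (hev : B.IsEven)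
    {C : Set (B.IsometryEquiv B)}
    (hC : ∀ (l₁ l₂ : List (UGen W)) (hl₁ : ∀ g ∈ l₁, g.IsAdmissible B x y) (hl₂ : ∀ g ∈ l₂, g.IsAdmissible B x y),
      (((UGen.evalEquiv h₁.isSymm h₁.xx h₁.yy l₂ hl₂).symm.trans (UGen.evalEquiv h₁.isSymm h₁.xx h₁.yy l₁ hl₁).symm).trans
          (UGen.evalEquiv h₁.isSymm h₁.xx h₁.yy l₂ hl₂)).trans (UGen.evalEquiv h₁.isSymm h₁.xx h₁.yy l₁ hl₁) ∈ C)
    (hxw : B x w = 0) (hyw : B y w = 0) (hx₁w : B x₁ w = 0) (hy₁w : B y₁ w = 0) (hww : B w w = q + q) :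
    IsWordIn C (LinearMap.BilinForm.IsometryEquiv.eichlerTransvection B h₁.isSymm y w q h₁.yy hyw hww) := by
  have hB := h₁.isSymm
  have hwy₁ : B w y₁ = 0 := by rw [hB.eq, hy₁w]
  have hwx₁ : B w x₁ = 0 := by rw [hB.eq, hx₁w]
  -- the three factors
  have hy' : B y (y₁ + w - q • x₁) = 0 := by
    rw [map_sub, map_add, map_smul, h₁.yy₁, hyw, h₁.yx₁, smul_zero, add_zero, sub_zero]
  have hn : B (y₁ + w - q • x₁) (y₁ + w - q • x₁) = 0 + 0 := by
    simp only [map_sub, map_add, map_smul, LinearMap.sub_apply, LinearMap.add_apply, LinearMap.smul_apply, smul_eq_mul,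
      h₁.y₁y₁, hy₁w, h₁.y₁x₁, hwy₁, hww, hwx₁, h₁.x₁y₁, hx₁w, h₁.x₁x₁]
    ring
  have hF₁ := isWordIn_commutators_eichlerTransvection_y_transport h₁ h₂ h₁₂ hev hC hxw hyw hx₁w hy₁w hww hy' hn
  have hyny₁ : B y (-y₁) = 0 := by rw [map_neg, h₁.yy₁, neg_zero]
  have hny₁ : B (-y₁) (-y₁) = 0 + 0 := by simp [h₁.y₁y₁]
  have hF₂ : IsWordIn C (LinearMap.BilinForm.IsometryEquiv.eichlerTransvection B hB y (-y₁) 0 h₁.yy hyny₁ hny₁) := by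
    refine (isWordIn_commutators_eichlerTransvection_y_y₁ h₁ h₂ h₁₂ hev hC (by rw [h₁.y₁y₁, add_zero])).symm.congr
      fun v ↦ ?_
    rw [LinearMap.BilinForm.IsometryEquiv.eichlerTransvection_symm_apply,
      LinearMap.BilinForm.IsometryEquiv.eichlerTransvection_apply]
  have hyq : B y (q • x₁) = 0 := by rw [map_smul, h₁.yx₁, smul_zero]
  have hqq : B (q • x₁) (q • x₁) = 0 + 0 := by simp [h₁.x₁x₁]
  have hF₃ := isWordIn_commutators_eichlerTransvection_y_smul_x₁ h₁ h₂ h₁₂ hev hC q hyq hqq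
  -- (t3) twice: `E(y, e₁', 0) ∘ E(y, −e₁, 0) ∘ E(y, q f₁, 0) = E(y, w, q)`
  have comp : B.eichlerTransvection y (y₁ + w - q • x₁) 0 ∘ₗ (B.eichlerTransvection y (-y₁) 0 ∘ₗ
      B.eichlerTransvection y (q • x₁) 0) = B.eichlerTransvection y w q := by
    rw [LinearMap.BilinForm.eichlerTransvection_comp B hB h₁.yy hyny₁ hyq,
      LinearMap.BilinForm.eichlerTransvection_comp B hB h₁.yy hy' (by rw [map_add, hyny₁, hyq, add_zero])]
    have hv : y₁ + w - q • x₁ + (-y₁ + q • x₁) = w := by module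
    have hp : (0 : ℤ) + (0 + 0 + B (-y₁) (q • x₁)) + B (y₁ + w - q • x₁) (-y₁ + q • x₁) = q := by
      simp only [map_add, map_sub, map_neg, map_smul, LinearMap.add_apply, LinearMap.sub_apply, LinearMap.neg_apply,
        LinearMap.smul_apply, smul_eq_mul, h₁.y₁y₁, h₁.y₁x₁, hwy₁, hwx₁, h₁.x₁y₁, h₁.x₁x₁]
      ring
    rw [hv, hp]
  refine ((hF₃.trans hF₂).trans hF₁).congr fun v ↦ ?_
  rw [LinearMap.BilinForm.IsometryEquiv.trans_apply, LinearMap.BilinForm.IsometryEquiv.trans_apply,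
    LinearMap.BilinForm.IsometryEquiv.eichlerTransvection_apply, LinearMap.BilinForm.IsometryEquiv.eichlerTransvection_apply,
    LinearMap.BilinForm.IsometryEquiv.eichlerTransvection_apply, LinearMap.BilinForm.IsometryEquiv.eichlerTransvection_apply,
    ← comp, LinearMap.comp_apply, LinearMap.comp_apply]

end Transport

/-! ### §4 Every admissible letter and word lies in `[E_U(L₁), E_U(L₁)]`: `E(L)` is perfect -/

section Perfect

variable {x y x₁ y₁ x₂ y₂ : W}

/-- **`t(e, l) ∈ [E_U(L₁), E_U(L₁)]` for every `l ∈ L₁`**: an admissible letter `E(y, a, q)` (`a ⊥ x, y`, `(a,a) = 2q`)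
factors by (t3) as `E(y, αf₁, 0) E(y, βe₁, 0) E(y, w, q − αβ)` with `α = (a,e₁)`, `β = (a,f₁)`,
`w = a − αf₁ − βe₁ ∈ L₀`. [cite: GritsenkoHulekSankaran2009, §4.1 ("t(e,l) for any l ∈ L₁ is a commutator")] -/
theorem isWordIn_commutators_toIsometryEquiv_atY (h₁ : TwoHyperbolicPairs B x y x₁ y₁)
    (h₂ : TwoHyperbolicPairs B x y x₂ y₂) (h₁₂ : TwoHyperbolicPairs B x₁ y₁ x₂ y₂) (hev : B.IsEven)
    {C : Set (B.IsometryEquiv B)}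
    (hC : ∀ (l₁ l₂ : List (UGen W)) (hl₁ : ∀ g ∈ l₁, g.IsAdmissible B x y) (hl₂ : ∀ g ∈ l₂, g.IsAdmissible B x y),
      (((UGen.evalEquiv h₁.isSymm h₁.xx h₁.yy l₂ hl₂).symm.trans (UGen.evalEquiv h₁.isSymm h₁.xx h₁.yy l₁ hl₁).symm).trans
          (UGen.evalEquiv h₁.isSymm h₁.xx h₁.yy l₂ hl₂)).trans (UGen.evalEquiv h₁.isSymm h₁.xx h₁.yy l₁ hl₁) ∈ C)
    (a : W) (q : ℤ) (hg : (UGen.atY a q).IsAdmissible B x y) :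
    IsWordIn C (UGen.toIsometryEquiv h₁.isSymm h₁.xx h₁.yy (UGen.atY a q) hg) := by
  have hB := h₁.isSymm
  obtain ⟨hxa, hya, hq⟩ := hg
  -- the decomposition `a = α x₁ + β y₁ + w`
  set α : ℤ := B y₁ a with hα
  set β : ℤ := B x₁ a with hβ
  set w : W := a - α • x₁ - β • y₁ with hw
  have hxw : B x w = 0 := by rw [hw, map_sub, map_sub, map_smul, map_smul, hxa, h₁.xx₁, h₁.xy₁]; simp
  have hyw : B y w = 0 := by rw [hw, map_sub, map_sub, map_smul, map_smul, hya, h₁.yx₁, h₁.yy₁]; simp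
  have hx₁w : B x₁ w = 0 := by
    rw [hw, map_sub, map_sub, map_smul, map_smul, ← hβ, h₁.x₁x₁, h₁.x₁y₁]; simp
  have hy₁w : B y₁ w = 0 := by
    rw [hw, map_sub, map_sub, map_smul, map_smul, ← hα, h₁.y₁y₁, h₁.y₁x₁]; simp
  have hww : B w w = (q - α * β) + (q - α * β) := by
    have hax₁ : B a x₁ = β := by rw [hB.eq, hβ]
    have hay₁ : B a y₁ = α := by rw [hB.eq, hα]
    simp only [hw, map_sub, map_smul, LinearMap.sub_apply, LinearMap.smul_apply, smul_eq_mul, hq, hax₁, hay₁, ← hα, ← hβ,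
      h₁.x₁x₁, h₁.x₁y₁, h₁.y₁x₁, h₁.y₁y₁]
    ring
  have hyα : B y (α • x₁) = 0 := by rw [map_smul, h₁.yx₁, smul_zero]
  have hαα : B (α • x₁) (α • x₁) = 0 + 0 := by simp [h₁.x₁x₁]
  have hyβ : B y (β • y₁) = 0 := by rw [map_smul, h₁.yy₁, smul_zero]
  have hββ : B (β • y₁) (β • y₁) = 0 + 0 := by simp [h₁.y₁y₁]
  have hF₁ := isWordIn_commutators_eichlerTransvection_y_smul_x₁ h₁ h₂ h₁₂ hev hC α hyα hαα
  have hF₂ := isWordIn_commutators_eichlerTransvection_y_smul_y₁ h₁ h₂ h₁₂ hev hC β hyβ hββ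
  have hF₃ := isWordIn_commutators_eichlerTransvection_y_of_ortho h₁ h₂ h₁₂ hev hC hxw hyw hx₁w hy₁w hww
  have comp : B.eichlerTransvection y (α • x₁) 0 ∘ₗ (B.eichlerTransvection y (β • y₁) 0 ∘ₗ
      B.eichlerTransvection y w (q - α * β)) = B.eichlerTransvection y a q := by
    rw [LinearMap.BilinForm.eichlerTransvection_comp B hB h₁.yy hyβ hyw,
      LinearMap.BilinForm.eichlerTransvection_comp B hB h₁.yy hyα (by rw [map_add, hyβ, hyw, add_zero])]
    have hv : α • x₁ + (β • y₁ + w) = a := by rw [hw]; module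
    have hp : (0 : ℤ) + (0 + (q - α * β) + B (β • y₁) w) + B (α • x₁) (β • y₁ + w) = q := by
      simp only [map_add, map_smul, LinearMap.smul_apply, smul_eq_mul, hy₁w, hx₁w, h₁.x₁y₁]
      ring
    rw [hv, hp]
  refine ((hF₃.trans hF₂).trans hF₁).congr fun v ↦ ?_
  rw [LinearMap.BilinForm.IsometryEquiv.trans_apply, LinearMap.BilinForm.IsometryEquiv.trans_apply,
    LinearMap.BilinForm.IsometryEquiv.eichlerTransvection_apply, LinearMap.BilinForm.IsometryEquiv.eichlerTransvection_apply,
    LinearMap.BilinForm.IsometryEquiv.eichlerTransvection_apply, UGen.toIsometryEquiv_apply]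
  change _ = B.eichlerTransvection y a q v
  rw [← comp, LinearMap.comp_apply, LinearMap.comp_apply]

/-- The same for the letters `t(f, l) = E(x, a, q)` (the base pair read as `(y, x)`). [cite: GritsenkoHulekSankaran2009, §4.1 ("t(e,u) and t(f,v)")] -/
theorem isWordIn_commutators_toIsometryEquiv (h₁ : TwoHyperbolicPairs B x y x₁ y₁)
    (h₂ : TwoHyperbolicPairs B x y x₂ y₂) (h₁₂ : TwoHyperbolicPairs B x₁ y₁ x₂ y₂) (hev : B.IsEven)
    {C : Set (B.IsometryEquiv B)}
    (hC : ∀ (l₁ l₂ : List (UGen W)) (hl₁ : ∀ g ∈ l₁, g.IsAdmissible B x y) (hl₂ : ∀ g ∈ l₂, g.IsAdmissible B x y),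
      (((UGen.evalEquiv h₁.isSymm h₁.xx h₁.yy l₂ hl₂).symm.trans (UGen.evalEquiv h₁.isSymm h₁.xx h₁.yy l₁ hl₁).symm).trans
          (UGen.evalEquiv h₁.isSymm h₁.xx h₁.yy l₂ hl₂)).trans (UGen.evalEquiv h₁.isSymm h₁.xx h₁.yy l₁ hl₁) ∈ C)
    (g : UGen W) (hg : g.IsAdmissible B x y) :
    IsWordIn C (UGen.toIsometryEquiv h₁.isSymm h₁.xx h₁.yy g hg) := by
  cases g with
  | atY a q => exact isWordIn_commutators_toIsometryEquiv_atY h₁ h₂ h₁₂ hev hC a q hg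
  | atX a q =>
    have hg' : (UGen.atY a q).IsAdmissible B y x := ⟨hg.2.1, hg.1, hg.2.2⟩
    have key := isWordIn_commutators_toIsometryEquiv_atY h₁.symm_left h₂.symm_left h₁₂ hev
      (forall_comm_mem_base_swap h₁.isSymm h₁.xx h₁.yy hC) a q hg'
    refine key.congr fun v ↦ ?_
    rw [UGen.toIsometryEquiv_apply, UGen.toIsometryEquiv_apply]
    rfl

/-- **`E(L)` is perfect for an even lattice containing three hyperbolic planes**: every element of `E_U(L₁)` — every
admissible word in the transvections `t(e,a)`, `t(f,a)`, `a ∈ L₁` — is a word in commutators `[α,β] = αβα⁻¹β⁻¹` of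
elements of `E_U(L₁)` (here: lies in `⟨C⟩` for any set `C` of isometries containing these commutators). With Prop. 3.3 (ii)
(`E(L) = E_U(L₁)`, row g49-#1) this is "`E(L)^{ab}` is trivial" for `L ⊇ U ⊕ U₁ ⊕ U₂` even — the integral case of Thm. 1.7's
`S̃O⁺(L)^{ab} = 1` (whose remaining input `S̃O⁺(L) = E(L)` is Prop. 3.4 / Kneser, not in the tree).
[cite: GritsenkoHulekSankaran2009, Thm. 1.7 and §4.1] -/
theorem isWordIn_commutators_evalEquiv (h₁ : TwoHyperbolicPairs B x y x₁ y₁) (h₂ : TwoHyperbolicPairs B x y x₂ y₂)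
    (h₁₂ : TwoHyperbolicPairs B x₁ y₁ x₂ y₂) (hev : B.IsEven) {C : Set (B.IsometryEquiv B)}
    (hC : ∀ (l₁ l₂ : List (UGen W)) (hl₁ : ∀ g ∈ l₁, g.IsAdmissible B x y) (hl₂ : ∀ g ∈ l₂, g.IsAdmissible B x y),
      (((UGen.evalEquiv h₁.isSymm h₁.xx h₁.yy l₂ hl₂).symm.trans (UGen.evalEquiv h₁.isSymm h₁.xx h₁.yy l₁ hl₁).symm).trans
          (UGen.evalEquiv h₁.isSymm h₁.xx h₁.yy l₂ hl₂)).trans (UGen.evalEquiv h₁.isSymm h₁.xx h₁.yy l₁ hl₁) ∈ C)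
    (l : List (UGen W)) (hl : ∀ g ∈ l, g.IsAdmissible B x y) :
    IsWordIn C (UGen.evalEquiv h₁.isSymm h₁.xx h₁.yy l hl) := by
  induction l with
  | nil => exact IsWordIn.refl
  | cons g l ih =>
    exact (ih fun g' hg' ↦ hl g' (List.mem_cons_of_mem g hg')).trans
      (isWordIn_commutators_toIsometryEquiv h₁ h₂ h₁₂ hev hC g (hl g List.mem_cons_self))

end Perfect

end Literature.Topology.FourManifolds

end
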